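import Literature.MathematicalPhysics.QuantumFieldTheory.Balaban1983to89.B9Eq315QTorusOnto

/-!
# `Balaban1983to89.B5Eq155FlatAveragingCommute` — T. Bałaban, *Propagators and renormalization transformations for lattice gauge theories. I*,
# Commun. Math. Phys. **95** (1984) 17–40 [Balaban1984PropagatorsI] ("B5" = ref. [4] of [Balaban1985BackgroundPropagators], ref. [2] of
# [Balaban1985Averaging]) (1.55) p. 27 «Q_k∂ = ∂₁Q′_k, ∂₁ is the unit lattice differentiation» and p. 27 «we can identify Q_kA₀ = B₀», AT THE
# pub-balaban NE9 CHAIN'S LETTERS, ONE STEP (`k = 1`), FLAT BACKGROUND: the one-step vector averaging `Q(1)` of [Balaban1985BackgroundPropagators]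
# (3.15) (`B9Eq315QTorus.QtorusW … (fun _ ↦ 1) …`) COMMUTES WITH THE GRADIENT up to the coarse gradient of the site averaging `Q′(1)` of (3.19)
# (`B9Eq326OperatorAssembly.QprimeW … (fun _ ↦ 1)`), and REPRODUCES THE CONSTANT VECTOR FUNCTIONS — hypotheses (H2) and (H3) of the NE9 owner's
# flat positivity `B5Eq172HodgePositivity` ∕ `B5Eq172FlatCoercivity` (gen 79) DISCHARGED

statement-level skeleton of published theorems with citation tags; proofs where landed; nothing here is a claim
about the Yang–Mills mass gap

PDF held: `paper:balaban1984-cmp95-propagators-rt-i` (journal page = PDF page + 16), pp. 20, 27–28 read by this seat (2026-08-21) in the held text layer;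
[Balaban1985Averaging] (2) p. 17, (124)–(125) p. 36 and [Balaban1985BackgroundPropagators] (3.3) p. 391, (3.15)∕(3.19) p. 393 through the verbatim
quotations of `B7Prop3GeneralLinear`, `B7Prop3Flat`, `B9Eq33CovDerivVector`, `B9Eq315QTorus`, `B9Eq319QprimeTorus`.

THE PRINT (verbatim).  [B5] p. 20 (1.18): *«(Q_kA)_b = Σ_{x∈B^k(b₋)} η^{d+1} A([x, x(b)]), b ⊂ T^{(k)}_1, η = L^{−k}, and x(b) is a point in B^k(b₊)
obtained from x by translation by b. If b = ⟨y, y + e_μ⟩, then x(b) = x + e_μ»*; (1.20): *«denoting (Q′_kλ)(y) = Σ_{x∈B^k(y)} η^d λ(x), we have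
Q_kA^λ = Q_kA − ∂Q′_kλ»*.  p. 27: *«The configuration A can be expressed in terms of A′ as follows: A = Δ^{−1/2}A′ + A₀, where A₀ is a constant
configuration. Substituting it into the other two equations in (1.49) and using the identity Q_k∂ = ∂₁Q′_k, (1.55) ∂₁ is the unit lattice
differentiation, we get …»*; *«It implies that B − Q_kA₀ is orthogonal to constant functions. Taking the decomposition B = B′ + B₀, where B₀ is a
constant configuration and B′ is in the orthogonal subspace, we can identify Q_kA₀ = B₀, or A₀ = Q*_kB₀.»*  ([B7] (125) p. 36, p. 27 and [B9] (3.3),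
(3.15), (3.19) as quoted verbatim in `B7Prop3GeneralLinear.Q0cov`, `B9Eq319QprimeTorus.Qprime_flat`, `B9Eq33CovDerivVector.covDeriv`, `B9Eq315QTorus`.)

WHY THIS FILE (cell context).  The pub-balaban NE9 BINDER-row owner (lineage `b2b-balaban-t4-ne9-p1`, gen 79) proves the COERCIVITY of the chain's
principal gauge-fixed operator `D*D + DR(1)D* + aQ(1)*Q(1)` at the flat background (the `hγ` of `Support/NE9CurChartOfBackground.
cur_chart_exists_of_principal_coercive` at `U := 1`) from a Hodge package (H0)–(H5) (`B5Eq172HodgePositivity`, `B5Eq172PoincareTorus`,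
`B5Eq172FlatCoercivity`), discharging (H0)(H1)(H4)(H5) himself and OFFERING (journal `[NE9P1-G79-INTENT2]`, O-ne9p1-g79-1) to the NE9 leaf seats the
two identities of the one-step VECTOR averaging `Q(1)`: (H2) = (1.55) `Q(1) ∘ D = ∂₁ ∘ Q′(1)` and (H3) = «Q_kA₀ = B₀» (constants to coarse constants,
injectively).  This file (leaf seat `b2b-balaban-t4-ne9-formalise-leaf-01`, gen 72) proves both for the tree's `Q(1)` — the `ℤ^d` linear part
`B7Prop3GeneralLinear.linQcov` read through the periodic extension, which at `V₀ = 1` IS the main term (125) (`linQcov_one_left`, `B7Prop3Flat.linQ`):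
every straight segment `[x, x + Le_κ]` of (125) TELESCOPES on a gradient, leaving the difference of two block means = the coarse gradient of `Q′(1)` —
stated LITERALLY in the shape of the binders `h155`, `hQHarm`, `hQinj` of `B5Eq172FlatCoercivity.exists_coercive_principal_flat` (real coarse scalar
`c′ := (L·η)⁻¹` = print's unit-lattice spacing; the constants `B5Eq172PoincareTorus.constBondL2K v` unfold to the `(WL2.equiv …).symm (fun b ↦ v b.2)` here).

WHAT IS PROVED (sorry-free; no definition, no `Prop` placeholder; no inequality of the papers).
* §1 bookkeeping for the periodic reading `perSite` and the blocks `blockOf`: **`shift_perSite`** (the torus step `+e_κ` IS the `ℤ^d` step read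
  periodically), `perSite_cornerSite_add_boxVec_apply_val` ∕ `_mem` ∕ `offset_…` ∕ `…_offset` (the point `L·y + r`, `r ∈ [0,L)^d`, reads as the site of
  `B(y)` with offset `r`; every site of `B(y)` is of this form), **`sum_blockOf_eq_sum_boxVec`** (`Σ_{x∈B(y)} F(x) = Σ_{r∈[0,L)^d} F(L·y + r)`),
  **`perSite_cornerSite_add_boxVec_add`** (`L·y + r + L·e_κ` reads as `L·(y + e_κ) + r`: the fine period absorbs the wrap of `y_κ`).
* §2 **`asum_flatGrad_seg`** (the path sum of a flat gradient along `[p, p + ne_κ]` telescopes), `perCfg_flatGrad`, **`linQ_perCfg_flatGrad`** (the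
  main term (125) of a flat torus gradient at the coarse bond `(y, κ)` is `Σ_r L^{−d}·c·(g(L(y+e_κ)+r) − g(Ly+r))`), `norm_perCfg_le`.
* §3 at the chain's letters: `adTransportW_flat`, `perCfg_one`, `toAlg_covDerivL2K_one`, **`QprimeW_one_apply`** (`Q′(1)` = the block mean,
  `Qprime_flat` BY NAME), **`equiv_QtorusW_one_covDerivL2K`** (`(Q(1)Dl)(y, κ) = (Lη)⁻¹·Σ_r L^{−d}(l(L(y+e_κ)+r) − l(Ly+r))`),
  `equiv_coarseGrad_QprimeW_one`, and **`QtorusW_one_comp_covDerivL2K`** = (1.55): `QtorusW L m hL φ 1 hα1 hU1 hreg ∘ₗ covDerivL2K ℂ c₀ η⁻¹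
  (adTransportW φ 1) = (covDerivL2K ℂ c₁ ↑((L·η)⁻¹) (fun _ ↦ id) ∘ₗ (WL2.linearEquiv ℂ ℂ _).symm) ∘ₗ QprimeW L m φ 1` — the `h155` binder of
  `B5Eq172FlatCoercivity.exists_coercive_principal_flat` at `c′ := ((L : ℝ) * η)⁻¹`.
* §4 **`QtorusW_one_constBond`** (`Q(1)` of the constant vector function `b ↦ v_{μ(b)}` is the same constant vector function on the coarse torus; the
  `κ`-dependent form of `B9Eq315QTowerFlat.QtorusLin_one_const`), **`constBond_eq_zero_of_QtorusW_one`** ((H3b):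
  injective on the constants — the coarse torus has a bond in every direction since `L·m_i ≥ 1`).
JUNCTION (scratch in the lineage folder `HOME/t4/b2b-balaban-t4-ne9-formalise-leaf-01/g72/probe/`, not filed): against the owner's STAGED (P)+(Q)+FILE 3,
`exists_coercive_principal_flat … hc' (QtorusW_one_comp_covDerivL2K …) (by rintro h ⟨v, rfl⟩; exact ⟨v, (QtorusW_one_constBond … v).symm⟩)
(by rintro h ⟨v, rfl⟩ h0; exact constBond_eq_zero_of_QtorusW_one … v h0)` elaborates (rc 0, standard axioms): the flat `hγ` is a CLOSED term given
only `η ≠ 0`, `a > 0`.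
MODEL ∕ DECLARED READINGS.  (M1) as `B9Eq315QTorus` ∕ `B5Eq172HodgePositivity` §5: fine torus `TSite d (L·m)`, coarse torus `TSite d m`, fibre `W` read
along `φ : W ≃ₗ[ℂ] 𝔸`, fine weight `c₀`, coarse weight `c₁` (free), the displayed background data `hα1` ∕ `hU1` ∕ `hreg` of `QtorusW` (inhabited at
`U ≡ 1`, `B9Eq315QTowerFlat`).  (M2) print's `∂₁` («unit lattice differentiation») for ONE step `η → Lη` is the flat forward difference of the coarse
torus with scalar `(Lη)⁻¹`, read into `BondL2K c₁` through `(WL2.linearEquiv …).symm` — the owner's `dC c′` at `c′ = (Lη)⁻¹`; at `η = 0` both sides of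
(1.55) vanish (`0⁻¹ = 0`), so no hypothesis on `η`.  (M3) one step (`k = 1`) only; the tower form is not needed by the consumer.
HONEST SCOPE.  [folklore] lattice calculus (telescoping sums, block bijection) identifying two of the tree's own operators at the flat background; no
estimate, no uniformity, nothing of Bałaban's inequalities asserted; NOT summit progress (cell pub-balaban: NE9 NOT PRINTED ∕ NOT PROVED; spine
PROVED 0∕9).  Filed by the pub-balaban NE9 leaf seat `b2b-balaban-t4-ne9-formalise-leaf-01` (gen 72) on the owner's OFFER O-ne9p1-g79-1; NEW file
importing `B9Eq315QTorusOnto` only; nothing modified.  Net new unproved facts: 0.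
-/

noncomputable section

open scoped BigOperators InnerProductSpace ComplexConjugate

namespace Literature.MathematicalPhysics.QuantumFieldTheory.Balaban1983to89.B5Eq155FlatAveragingCommute

open B4Sect5Torus (TSite)
open B9SectCLatticeCarrier (Bond shift shift_apply_val shift_apply_ne bpos btgt)
open B7Prop1Explicit (e e_apply boxVec seg asum asum_seg_natCast U1 Wcx)
open B7Prop3Flat (linQ)
open B7Prop3GeneralLinear (linQcov linQcov_one_left)
open B7Eq125RightInverse (corner corner_apply corner_add)
open B9Eq33CovDerivVector (covDeriv covDeriv_apply)
open B9Eq311L2Pairing (WL2)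
open B11Eq103H1Complex (SiteL2K BondL2K covDerivL2K equiv_covDerivL2K)
open B9Eq310HessianOperator (adTransportW adTransportW_apply)
open B9Eq319QprimeTorus (fineP centre blockCoord blockCoord_apply_val mem_blockOf_iff offset offset_lt Qprime Qprime_flat QprimeLin QprimeLin_apply)
open B9Eq326OperatorAssembly (QprimeW)
open B9Eq315QTorus (perSite perCfg perCfg_apply cornerSite QtorusLin QtorusLin_apply QtorusW QtorusW_apply)
open B9Eq315QTorusOnto (liftSite periodVec perSite_add_periodVec perSite_liftSite liftSite_perSite_add cornerSite_eq)

variable {d : ℕ}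

/-! ## §1 Lattice bookkeeping: unit steps of the periodic reading, block sites -/

section Lattice

variable (P : Fin d → ℕ)

/-- The representative of `y + e_κ` is that of `y` plus `e_κ`, up to a period (the wrap at `y_κ = P_κ − 1`). [cite: Balaban1985Averaging, (1) p.17] -/
theorem liftSite_shift_add_periodVec (y : TSite d P) (κ : Fin d) :
    liftSite (shift κ y) + periodVec P (Pi.single κ ((((y κ : ℕ) + 1) / P κ : ℕ) : ℤ)) = liftSite y + e κ := by
  funext i
  by_cases h : i = κ
  · subst h
    simp only [liftSite, periodVec, e, Pi.add_apply, shift_apply_val, Pi.single_eq_same]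
    exact_mod_cast Nat.mod_add_div ((y i : ℕ) + 1) (P i)
  · simp only [liftSite, periodVec, e, Pi.add_apply, shift_apply_ne h, Pi.single_eq_of_ne h, mul_zero, add_zero]

variable [∀ i, NeZero (P i)]

/-- Reading `liftSite y + e_κ` on the torus gives `y + e_κ`. [cite: Balaban1985Averaging, (1) p.17] -/
theorem perSite_liftSite_add_e (y : TSite d P) (κ : Fin d) : perSite P (liftSite y + e κ) = shift κ y := by
  rw [← liftSite_shift_add_periodVec P y κ, perSite_add_periodVec, perSite_liftSite]

/-- **The torus step `shift κ` IS the `ℤ^d` step `+ e_κ` under the periodic reading.** [cite: Balaban1985Averaging, (1) p.17] -/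
theorem shift_perSite (z : B7Prop1Explicit.Site d) (κ : Fin d) : shift κ (perSite P z) = perSite P (z + e κ) := by
  conv_rhs => rw [← liftSite_perSite_add P z, add_right_comm, perSite_add_periodVec]
  rw [perSite_liftSite_add_e]

end Lattice

section Blocks

variable (L : ℕ) [NeZero L] (m : Fin d → ℕ) [∀ i, NeZero (fineP L m i)]

omit [NeZero L] in
/-- **The periodic reading of the `ℤ^d` point `L·y + r` (`r ∈ [0, L)^d`) is the site of the block `B(y)` with coordinates `L·y_i + r_i`** (no wrap:
`L·y_i + r_i < L·m_i`). [cite: Balaban1985Averaging, (2) p.17] -/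
theorem perSite_cornerSite_add_boxVec_apply_val (y : TSite d m) (r : Fin d → Fin L) (i : Fin d) :
    ((perSite (fineP L m) (cornerSite L y + boxVec L r) i : ℕ)) = L * (y i : ℕ) + (r i : ℕ) := by
  have hlt : L * (y i : ℕ) + (r i : ℕ) < fineP L m i :=
    calc L * (y i : ℕ) + (r i : ℕ) < L * ((y i : ℕ) + 1) := by have := (r i).isLt; rw [Nat.mul_succ]; omega
      _ ≤ L * m i := Nat.mul_le_mul_left _ (y i).isLt
  have hlt' : (L : ℤ) * ((y i : ℕ) : ℤ) + ((r i : ℕ) : ℤ) < ((fineP L m i : ℕ) : ℤ) := by exact_mod_cast hlt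
  have h0 : (0 : ℤ) ≤ (L : ℤ) * ((y i : ℕ) : ℤ) + ((r i : ℕ) : ℤ) := by positivity
  simp only [perSite, cornerSite, boxVec, Pi.add_apply, Int.emod_eq_of_lt h0 hlt']
  exact_mod_cast Int.toNat_natCast (L * (y i : ℕ) + (r i : ℕ))

/-- `L·y + r` lies in the block `B(y)`. [cite: Balaban1985Averaging, (2) p.17] -/
theorem perSite_cornerSite_add_boxVec_mem (y : TSite d m) (r : Fin d → Fin L) :
    perSite (fineP L m) (cornerSite L y + boxVec L r) ∈ B9Eq319QprimeTorus.blockOf L m y := by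
  refine (mem_blockOf_iff L m y _).2 (funext fun i => Fin.ext ?_)
  rw [blockCoord_apply_val, perSite_cornerSite_add_boxVec_apply_val, Nat.mul_add_div (Nat.pos_of_ne_zero (NeZero.ne L)),
    Nat.div_eq_of_lt (r i).isLt, add_zero]

omit [NeZero L] in
/-- The offset of `L·y + r` inside its block is `r`. [cite: Balaban1985Averaging, (2) p.17] -/
theorem offset_perSite_cornerSite_add_boxVec (y : TSite d m) (r : Fin d → Fin L) (i : Fin d) :
    offset L m (perSite (fineP L m) (cornerSite L y + boxVec L r)) i = (r i : ℕ) := by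
  rw [offset, perSite_cornerSite_add_boxVec_apply_val, Nat.mul_add_mod, Nat.mod_eq_of_lt (r i).isLt]

/-- Every site of `B(y)` is `L·y + r` with `r` its offset. [cite: Balaban1985Averaging, (2) p.17] -/
theorem perSite_cornerSite_add_boxVec_offset {y : TSite d m} {x : TSite d (fineP L m)} (hx : x ∈ B9Eq319QprimeTorus.blockOf L m y) :
    perSite (fineP L m) (cornerSite L y + boxVec L fun i => ⟨offset L m x i, offset_lt L m x i⟩) = x := by
  rw [mem_blockOf_iff] at hx
  refine funext fun i => Fin.ext ?_
  rw [perSite_cornerSite_add_boxVec_apply_val, ← hx, blockCoord_apply_val]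
  exact Nat.div_add_mod _ _

/-- **Sums over the block `B(y)` are sums over the offsets `r ∈ [0, L)^d` of the periodically read points `L·y + r`** (the bijection
`x ↦ (x_i mod L)_i`; cf. the pub-balaban NE9 owner's `card_blockOf`). [cite: Balaban1985Averaging, (2) p.17] -/
theorem sum_blockOf_eq_sum_boxVec {M : Type*} [AddCommMonoid M] (F : TSite d (fineP L m) → M) (y : TSite d m) :
    ∑ x ∈ B9Eq319QprimeTorus.blockOf L m y, F x = ∑ r : Fin d → Fin L, F (perSite (fineP L m) (cornerSite L y + boxVec L r)) := by
  refine Finset.sum_nbij' (fun x i => ⟨offset L m x i, offset_lt L m x i⟩) (fun r => perSite (fineP L m) (cornerSite L y + boxVec L r))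
    (fun _ _ => Finset.mem_univ _) (fun r _ => perSite_cornerSite_add_boxVec_mem L m y r) (fun x hx => ?_) (fun r _ => ?_) (fun x hx => ?_)
  · exact perSite_cornerSite_add_boxVec_offset L m hx
  · exact funext fun i => Fin.ext (offset_perSite_cornerSite_add_boxVec L m y r i)
  · rw [perSite_cornerSite_add_boxVec_offset L m hx]

omit [NeZero L] in
/-- **`L·y + r + L·e_κ` reads as `L·(y + e_κ) + r`** on the fine torus (the two points differ by a fine period when `y_κ` wraps). [cite: Balaban1985Averaging, (2) p.17] -/
theorem perSite_cornerSite_add_boxVec_add (y : TSite d m) (r : Fin d → Fin L) (κ : Fin d) :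
    perSite (fineP L m) (cornerSite L y + boxVec L r + (L : ℤ) • e κ) = perSite (fineP L m) (cornerSite L (shift κ y) + boxVec L r) := by
  have hc : cornerSite L y + (L : ℤ) • e κ =
      cornerSite L (shift κ y) + periodVec (fineP L m) (Pi.single κ ((((y κ : ℕ) + 1) / m κ : ℕ) : ℤ)) := by
    have h1 : (L : ℤ) • e κ = corner L (e κ) := by
      funext i; simp only [corner_apply, e, Pi.smul_apply, smul_eq_mul, Pi.single_apply, mul_ite, mul_one, mul_zero]
    have h2 : periodVec (fineP L m) (Pi.single κ ((((y κ : ℕ) + 1) / m κ : ℕ) : ℤ)) =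
        corner L (periodVec m (Pi.single κ ((((y κ : ℕ) + 1) / m κ : ℕ) : ℤ))) := by
      funext i; simp only [corner_apply, periodVec, fineP, Nat.cast_mul]; ring
    rw [cornerSite_eq, cornerSite_eq, h1, h2, ← corner_add, ← corner_add, liftSite_shift_add_periodVec]
  rw [add_right_comm, hc, add_right_comm, perSite_add_periodVec]

end Blocks

/-! ## §2 The fine side at `U = 1`: the straight-segment sums of a flat gradient telescope to a difference of block means -/

section Fine

variable {𝔸 : Type*} [NormedRing 𝔸] [NormedAlgebra ℂ 𝔸]

/-- **Telescoping along a straight segment**: for the flat gradient `b ↦ c·(g(b₊) − g(b₋))` of a function `g` on `ℤ^d`,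
`Σ_{b ⊂ [p, p + n e_κ]} c·(g(b₊) − g(b₋)) = c·(g(p + n e_κ) − g(p))`. [cite: Balaban1984PropagatorsI, (1.55) p.27] -/
theorem asum_flatGrad_seg (g : B7Prop1Explicit.Site d → 𝔸) (c : ℂ) (p : B7Prop1Explicit.Site d) (κ : Fin d) (n : ℕ) :
    asum (fun z μ => c • (g (z + e μ) - g z)) p (seg κ n) = c • (g (p + (n : ℤ) • e κ) - g p) := by
  rw [asum_seg_natCast, ← Finset.smul_sum]
  congr 1
  have h := Finset.sum_range_sub (fun i : ℕ => g (p + (i : ℤ) • e κ)) n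
  simp only [Nat.cast_zero, zero_smul, add_zero] at h
  rw [← h]
  refine Finset.sum_congr rfl fun i _ => ?_
  rw [Nat.cast_succ, add_smul, one_smul, add_assoc]

variable (P : Fin d → ℕ) [∀ i, NeZero (P i)]

/-- The periodic extension of the flat torus gradient `b ↦ c·(g(b₊) − g(b₋))` ((3.3) at `R ≡ 1`) is the flat `ℤ^d` gradient of the
periodic extension of `g`. [cite: Balaban1985BackgroundPropagators, (3.3) p.391; Balaban1985Averaging, (1) p.17] -/
theorem perCfg_flatGrad (g : TSite d P → 𝔸) (c : ℂ) :
    perCfg P (fun b : Bond d P => c • (g (btgt b) - g (bpos b))) = fun z μ => c • (g (perSite P (z + e μ)) - g (perSite P z)) := by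
  funext z μ
  rw [perCfg_apply, ← shift_perSite]

variable (L : ℕ) (m : Fin d → ℕ) [∀ i, NeZero (fineP L m i)]

/-- **The main term (125) of `Q(1)` on a flat gradient is a difference of block means**: for the `L`-bond `c = (y, κ)` of the coarse torus,
`L·(Q₀(Dg))_c = Σ_{r∈[0,L)^d} L^{−d}·c·(g(L(y+e_κ) + r) − g(Ly + r))` — each straight segment `[x, x + Le_κ]` telescopes.
[cite: Balaban1984PropagatorsI, (1.55) p.27; Balaban1985Averaging, (125) p.36] -/
theorem linQ_perCfg_flatGrad (g : TSite d (fineP L m) → 𝔸) (c : ℂ) (y : TSite d m) (κ : Fin d) :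
    linQ L (perCfg (fineP L m) fun b : Bond d (fineP L m) => c • (g (btgt b) - g (bpos b))) (cornerSite L y) κ =
      ∑ r : Fin d → Fin L, (((L : ℝ) ^ d)⁻¹) •
        (c • (g (perSite (fineP L m) (cornerSite L (shift κ y) + boxVec L r)) - g (perSite (fineP L m) (cornerSite L y + boxVec L r)))) := by
  rw [perCfg_flatGrad, linQ]
  refine Finset.sum_congr rfl fun r _ => ?_
  rw [asum_flatGrad_seg (fun z => g (perSite (fineP L m) z)) c _ κ L, perSite_cornerSite_add_boxVec_add]

omit [NormedAlgebra ℂ 𝔸] [∀ i, NeZero (fineP L m i)] in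
/-- A torus bond function read periodically on `ℤ^d` is bounded by the sum of its finitely many norms (the bound `M` fed to
`B7Prop3GeneralLinear.linQcov_one_left`). [cite: Balaban1985Averaging, (1) p.17] -/
theorem norm_perCfg_le {P : Fin d → ℕ} [∀ i, NeZero (P i)] (A : Bond d P → 𝔸) (x : B7Prop1Explicit.Site d) (κ : Fin d) :
    ‖perCfg P A x κ‖ ≤ ∑ b : Bond d P, ‖A b‖ := by
  rw [perCfg_apply]
  exact Finset.single_le_sum (f := fun b : Bond d P => ‖A b‖) (fun b _ => norm_nonneg _) (Finset.mem_univ (perSite P x, κ))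

end Fine

/-! ## §3 The chain's letters at the flat background: `Q(1)` on a gradient, `Q′(1)`, and (1.55) -/

section Flat

variable {𝔸 : Type*} [NormedRing 𝔸] [NormedAlgebra ℂ 𝔸] [CompleteSpace 𝔸] [NormOneClass 𝔸]
  (L : ℕ) [NeZero L] (m : Fin d → ℕ) [∀ i, NeZero (fineP L m i)] (hL : 1 ≤ L)
  {W : Type*} [NormedAddCommGroup W] [InnerProductSpace ℂ W] (φ : W ≃ₗ[ℂ] 𝔸) {c₀ c₁ : ℝ} [Fact (0 < c₀)] [Fact (0 < c₁)]
  {α : ℝ} (hα1 : α ≤ 1 / 64)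
  (hU1 : ∀ (x : B7Prop1Explicit.Site d) (κ : Fin d), perCfg (fineP L m) (fun _ : Bond d (fineP L m) => (1 : 𝔸ˣ)) x κ ∈ U1 𝔸)
  (hreg : ∀ (y : TSite d m) (κ : Fin d) (r : Fin d → Fin L),
    ‖((Wcx L (perCfg (fineP L m) (fun _ : Bond d (fineP L m) => (1 : 𝔸ˣ))) (cornerSite L y) κ (boxVec L r) : 𝔸ˣ) : 𝔸) - 1‖ ≤ α)
  (η : ℝ)

omit [CompleteSpace 𝔸] [NormOneClass 𝔸] in
/-- At the flat background the transporter read on the Hilbert fibre is the identity, on any lattice. [cite: Balaban1985BackgroundPropagators, p.390] -/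
theorem adTransportW_flat {P : Fin d → ℕ} (b : Bond d P) : adTransportW φ (fun _ : Bond d P => (1 : 𝔸ˣ)) b = LinearMap.id := by
  apply LinearMap.ext
  intro w
  rw [adTransportW_apply, LinearMap.id_apply, Units.val_one, inv_one, Units.val_one, one_mul, mul_one, LinearEquiv.symm_apply_apply]

omit [NormedAlgebra ℂ 𝔸] [CompleteSpace 𝔸] [NormOneClass 𝔸] in
/-- The periodic extension of the flat background is the flat `ℤ^d` background. [cite: Balaban1985Averaging, (1) p.17] -/
theorem perCfg_one {P : Fin d → ℕ} [∀ i, NeZero (P i)] : perCfg P (fun _ : Bond d P => (1 : 𝔸ˣ)) = 1 := rfl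

omit [CompleteSpace 𝔸] [NormOneClass 𝔸] in
/-- **The flat gradient `D l` ((3.3) at `U ≡ 1`, scalar `c`) read in the algebra**: `b ↦ c·(φ l(b₊) − φ l(b₋))`.
[cite: Balaban1985BackgroundPropagators, (3.3) p.391] -/
theorem toAlg_covDerivL2K_one {P : Fin d → ℕ} (c : ℂ) (l : SiteL2K ℂ d P c₀ W) :
    (fun b => φ (WL2.equiv ℂ _ W (covDerivL2K ℂ c₀ c (adTransportW φ (fun _ : Bond d P => (1 : 𝔸ˣ))) l) b)) =
      fun b : Bond d P => c • (φ (WL2.equiv ℂ _ W l (btgt b)) - φ (WL2.equiv ℂ _ W l (bpos b))) := by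
  funext b
  rw [equiv_covDerivL2K, covDeriv_apply, adTransportW_flat, LinearMap.id_apply, map_smul, map_sub]

omit [CompleteSpace 𝔸] [NormOneClass 𝔸] [∀ i, NeZero (fineP L m i)] [Fact (0 < c₀)] in
/-- **`Q′(1)` of the chain is the plain block mean**: `(Q′(1)λ)(y) = Σ_{x∈B(y)} L^{−d} λ(x)` ([B7] p. 27 / [B5] p. 20 (1.11)), for the
`L²`-reading `QprimeW` of (3.19). [cite: Balaban1985Averaging, p.27; Balaban1985BackgroundPropagators, (3.19) p.393] -/
theorem QprimeW_one_apply (l : SiteL2K ℂ d (fineP L m) c₀ W) (y : TSite d m) :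
    QprimeW L m φ (fun _ : Bond d (fineP L m) => (1 : 𝔸ˣ)) l y = ∑ x ∈ B9Eq319QprimeTorus.blockOf L m y, ((L : ℝ) ^ d)⁻¹ • WL2.equiv ℂ _ W l x := by
  rw [QprimeW, LinearMap.comp_apply, LinearEquiv.coe_toLinearMap, WL2.linearEquiv_apply, QprimeLin_apply]
  have h : (fun b : Bond d (fineP L m) => (adTransportW φ (fun _ : Bond d (fineP L m) => (1 : 𝔸ˣ)) b).restrictScalars ℝ) =
      fun _ => LinearMap.id := by
    funext b; rw [adTransportW_flat, LinearMap.restrictScalars_id]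
  rw [h, Qprime_flat]

omit [NeZero L] [Fact (0 < c₁)] in
/-- **THE VALUE OF `Q(1)(Dl)` AT A COARSE BOND** `(y, κ)`: `(Lη)⁻¹ · Σ_{r∈[0,L)^d} L^{−d}(l(L(y+e_κ)+r) − l(Ly+r))` — the block spine segments
of (125) telescope ([B5] p. 27: «Q_k∂ = ∂₁Q′_k»), the frame terms of (124) vanish at `V₀ = 1` (`linQcov_one_left`).
[cite: Balaban1984PropagatorsI, (1.55) p.27; Balaban1985Averaging, (124)–(125) p.36; Balaban1985BackgroundPropagators, (3.15) p.393] -/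
theorem equiv_QtorusW_one_covDerivL2K (l : SiteL2K ℂ d (fineP L m) c₀ W) (y : TSite d m) (κ : Fin d) :
    WL2.equiv ℂ _ W (QtorusW L m hL φ (fun _ => 1) hα1 hU1 hreg (c₁ := c₁)
        (covDerivL2K ℂ c₀ ((η : ℂ))⁻¹ (adTransportW φ (fun _ : Bond d (fineP L m) => (1 : 𝔸ˣ))) l)) (y, κ) =
      (((L : ℂ))⁻¹ * ((η : ℂ))⁻¹) •
        ∑ r : Fin d → Fin L, (((L : ℂ)) ^ d)⁻¹ •
          (WL2.equiv ℂ _ W l (perSite (fineP L m) (cornerSite L (shift κ y) + boxVec L r)) -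
            WL2.equiv ℂ _ W l (perSite (fineP L m) (cornerSite L y + boxVec L r))) := by
  rw [QtorusW_apply, QtorusLin_apply, toAlg_covDerivL2K_one, perCfg_one,
    linQcov_one_left L hL _ (Finset.sum_nonneg fun b _ => norm_nonneg _) (norm_perCfg_le _),
    linQ_perCfg_flatGrad L m (fun x => φ (WL2.equiv ℂ _ W l x)) _ y κ, LinearEquiv.symm_apply_eq]
  simp only [map_smul, map_sum, map_sub, ← Complex.coe_smul, Finset.smul_sum, smul_sub, smul_smul]
  refine Finset.sum_congr rfl fun r _ => ?_
  push_cast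
  ring_nf

omit [CompleteSpace 𝔸] [NormOneClass 𝔸] [Fact (0 < c₀)] in
/-- **THE VALUE OF `∂₁(Q′(1)l)` AT A COARSE BOND** `(y, κ)` for the coarse flat gradient `∂₁ = c′·d₀` ((3.3) on the coarse torus at `R ≡ id`,
real scalar `c′`; print's `(Lη)⁻¹`), read into `BondL2K c₁` exactly as in the pub-balaban NE9 owner's `B5Eq172FlatCoercivity` (gen 79):
`c′ · (Σ_{x∈B(y+e_κ)} L^{−d}l(x) − Σ_{x∈B(y)} L^{−d}l(x))`. [cite: Balaban1984PropagatorsI, (1.55) p.27] -/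
theorem equiv_coarseGrad_QprimeW_one (c' : ℝ) (l : SiteL2K ℂ d (fineP L m) c₀ W) (y : TSite d m) (κ : Fin d) :
    WL2.equiv ℂ _ W ((covDerivL2K ℂ c₁ ((c' : ℂ)) (fun _ : Bond d m => (LinearMap.id : W →ₗ[ℂ] W)) ∘ₗ
        (WL2.linearEquiv ℂ ℂ (fun _ : TSite d m => c₁)).symm.toLinearMap) (QprimeW L m φ (fun _ : Bond d (fineP L m) => (1 : 𝔸ˣ)) l))
        (y, κ) =
      ((c' : ℂ)) •
        ∑ r : Fin d → Fin L, (((L : ℂ)) ^ d)⁻¹ •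
          (WL2.equiv ℂ _ W l (perSite (fineP L m) (cornerSite L (shift κ y) + boxVec L r)) -
            WL2.equiv ℂ _ W l (perSite (fineP L m) (cornerSite L y + boxVec L r))) := by
  rw [LinearMap.comp_apply, equiv_covDerivL2K, covDeriv_apply, LinearMap.id_apply, LinearEquiv.coe_toLinearMap,
    WL2.linearEquiv_symm_apply, Equiv.apply_symm_apply]
  change _ • (QprimeW L m φ _ l (shift κ y) - QprimeW L m φ _ l y) = _
  rw [QprimeW_one_apply, QprimeW_one_apply, sum_blockOf_eq_sum_boxVec, sum_blockOf_eq_sum_boxVec, ← Finset.sum_sub_distrib]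
  simp only [← Complex.coe_smul, smul_sub]
  push_cast
  rfl

/-- **[B5] (1.55) `Q_k∂ = ∂₁Q′_k` AT THE NE9 CHAIN'S LETTERS, `k = 1`, FLAT BACKGROUND** — «∂₁ is the unit lattice differentiation»: the one-step
vector averaging `Q(1)` of (3.15) composed with the gradient `D` of (3.3) (scalar `η⁻¹`) IS the coarse flat gradient of spacing `Lη` composed with
the site averaging `Q′(1)` of (3.19) — LITERALLY the binder `h155` of `B5Eq172HodgePositivity.exists_coercive_principal_flat_of_hodge` with
`dC := covDerivL2K ℂ c₁ (c′ : ℂ) (fun _ ↦ id) ∘ₗ (WL2.linearEquiv ℂ ℂ _).symm` at the real scalar `c′ := (L·η)⁻¹` (the coarse site functions read in the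
weighted `L²` space of weight `c₁`, then (3.3) at the identity transporter on the COARSE torus) — i.e. EXACTLY the `h155` binder of the pub-balaban NE9
owner's `B5Eq172FlatCoercivity.exists_coercive_principal_flat` (gen 79) at `c′ := ((L : ℝ) * η)⁻¹` (`≠ 0` iff `L ≠ 0 ∧ η ≠ 0`). [cite: Balaban1984PropagatorsI, (1.55) p.27, (1.20) p.20;
Balaban1985BackgroundPropagators, (3.3) p.391, (3.15) p.393, (3.19) p.393] -/
theorem QtorusW_one_comp_covDerivL2K :
    QtorusW L m hL φ (fun _ => 1) hα1 hU1 hreg (c₁ := c₁) ∘ₗ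
        covDerivL2K ℂ c₀ ((η : ℂ))⁻¹ (adTransportW φ (fun _ : Bond d (fineP L m) => (1 : 𝔸ˣ))) =
      (covDerivL2K ℂ c₁ (((((L : ℝ) * η)⁻¹ : ℝ) : ℂ)) (fun _ : Bond d m => (LinearMap.id : W →ₗ[ℂ] W)) ∘ₗ
          (WL2.linearEquiv ℂ ℂ (fun _ : TSite d m => c₁)).symm.toLinearMap) ∘ₗ
        QprimeW L m φ (fun _ : Bond d (fineP L m) => (1 : 𝔸ˣ)) := by
  apply LinearMap.ext
  intro l
  apply (WL2.equiv ℂ (fun _ : Bond d m => c₁) W).injective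
  funext c
  obtain ⟨y, κ⟩ := c
  rw [LinearMap.comp_apply, equiv_QtorusW_one_covDerivL2K, LinearMap.comp_apply, equiv_coarseGrad_QprimeW_one]
  push_cast
  rw [mul_inv]

end Flat

/-! ## §4 [B5] p. 27 «Q_kA₀ = B₀»: `Q(1)` maps the constant vector functions to the coarse constant vector functions, injectively -/

section Const

variable {𝔸 : Type*} [NormedRing 𝔸] [NormedAlgebra ℂ 𝔸] [CompleteSpace 𝔸] [NormOneClass 𝔸]
  (L : ℕ) (m : Fin d → ℕ) [∀ i, NeZero (fineP L m i)] (hL : 1 ≤ L)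
  {W : Type*} [NormedAddCommGroup W] [InnerProductSpace ℂ W] (φ : W ≃ₗ[ℂ] 𝔸) {c₀ c₁ : ℝ}
  {α : ℝ} (hα1 : α ≤ 1 / 64)
  (hU1 : ∀ (x : B7Prop1Explicit.Site d) (κ : Fin d), perCfg (fineP L m) (fun _ : Bond d (fineP L m) => (1 : 𝔸ˣ)) x κ ∈ U1 𝔸)
  (hreg : ∀ (y : TSite d m) (κ : Fin d) (r : Fin d → Fin L),
    ‖((Wcx L (perCfg (fineP L m) (fun _ : Bond d (fineP L m) => (1 : 𝔸ˣ))) (cornerSite L y) κ (boxVec L r) : 𝔸ˣ) : 𝔸) - 1‖ ≤ α)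

/-- **«B = B′ + B₀, where B₀ is a constant configuration … we can identify Q_kA₀ = B₀»: `Q(1)` OF A CONSTANT VECTOR FUNCTION `b ↦ v_{μ(b)}` IS THE
SAME CONSTANT VECTOR FUNCTION on the coarse torus** — at `V₀ = 1` every spine segment of (125) in direction `κ` carries `L` copies of `v_κ`, weighted
`L^{−(d+1)}` over the `L^d` block sites (the `κ`-dependent version of `B9Eq315QTowerFlat.QtorusLin_one_const`); the constant vector functions are
`B5Eq172PoincareTorus.constBondL2K v` (pub-balaban NE9 owner, gen 79), which unfolds to the `(WL2.equiv …).symm (fun b => v b.2)` used here.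
[cite: Balaban1984PropagatorsI, p.27, (1.72) p.30; Balaban1985Averaging, (124)–(125) p.36; Balaban1985BackgroundPropagators, (3.15) p.393] -/
theorem QtorusW_one_constBond (v : Fin d → W) :
    QtorusW L m hL φ (fun _ => 1) hα1 hU1 hreg (c₁ := c₁) ((WL2.equiv ℂ (fun _ : Bond d (fineP L m) => c₀) W).symm fun b => v b.2) =
      (WL2.equiv ℂ (fun _ : Bond d m => c₁) W).symm fun b => v b.2 := by
  have hL0 : L ≠ 0 := by omega
  have hLr : (L : ℝ) ≠ 0 := by exact_mod_cast hL0
  have hLc : (L : ℂ) ≠ 0 := by exact_mod_cast hL0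
  apply (WL2.equiv ℂ (fun _ : Bond d m => c₁) W).injective
  funext c
  obtain ⟨y, κ⟩ := c
  rw [QtorusW_apply, Equiv.apply_symm_apply, Equiv.apply_symm_apply, QtorusLin_apply, perCfg_one,
    show perCfg (fineP L m) (fun b : Bond d (fineP L m) => φ (v b.2)) = fun _ μ => φ (v μ) from rfl,
    linQcov_one_left L hL _ (Finset.sum_nonneg fun μ _ => norm_nonneg _)
      (fun _ μ => Finset.single_le_sum (f := fun μ : Fin d => ‖φ (v μ)‖) (fun μ _ => norm_nonneg _) (Finset.mem_univ μ)),
    LinearEquiv.symm_apply_eq]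
  simp only [linQ, asum_seg_natCast, Finset.sum_const, Finset.card_range, Finset.card_univ, Fintype.card_pi, Finset.prod_const,
    Fintype.card_fin]
  rw [← Nat.cast_smul_eq_nsmul ℝ (L ^ d), smul_smul, Nat.cast_pow, mul_inv_cancel₀ (pow_ne_zero _ hLr), one_smul,
    ← Nat.cast_smul_eq_nsmul ℂ L, smul_smul, inv_mul_cancel₀ hLc, one_smul]

/-- **(H3) of `B5Eq172HodgePositivity`, injectivity half: `Q(1)` is INJECTIVE on the constant vector functions** («Q_kA₀ = B₀ … A₀ = 0»): if `Q(1)` of the constant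
vector function of `v` vanishes then so does the constant vector function (the coarse torus has a bond in every direction). [cite: Balaban1984PropagatorsI, p.27, (1.72) p.30] -/
theorem constBond_eq_zero_of_QtorusW_one (v : Fin d → W)
    (h : QtorusW L m hL φ (fun _ => 1) hα1 hU1 hreg (c₁ := c₁) ((WL2.equiv ℂ (fun _ : Bond d (fineP L m) => c₀) W).symm fun b => v b.2) = 0) :
    ((WL2.equiv ℂ (fun _ : Bond d (fineP L m) => c₀) W).symm fun b => v b.2) = 0 := by
  rw [QtorusW_one_constBond] at h
  -- the coarse torus is inhabited: `m_i ≥ 1` since `L·m_i ≥ 1`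
  have y₀ : TSite d m := fun i => ⟨0, Nat.pos_of_ne_zero fun hm => NeZero.ne (fineP L m i) (by rw [fineP, hm, mul_zero])⟩
  have hv : ∀ μ, v μ = 0 := fun μ => by
    have := congr_fun (congrArg (WL2.equiv ℂ (fun _ : Bond d m => c₁) W) h) (y₀, μ)
    rwa [Equiv.apply_symm_apply, WL2.equiv_zero, Pi.zero_apply] at this
  apply (WL2.equiv ℂ (fun _ : Bond d (fineP L m) => c₀) W).injective
  funext b
  rw [Equiv.apply_symm_apply, WL2.equiv_zero, Pi.zero_apply, hv]

end Const

end Literature.MathematicalPhysics.QuantumFieldTheory.Balaban1983to89.B5Eq155FlatAveragingCommute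

end
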